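import Literature.MathematicalPhysics.QuantumFieldTheory.Balaban1983to89.B6MultiLevelTorusMirrorDirichlet

/-!
# `Balaban1983to89.B6MultiLevelTorusMirrorCompression` — [Balaban1985BackgroundPropagators] p. 394 «Δ′_a↾Ω₀ = Ω₀Δ′_aΩ₀ … Its inverse is denoted by G′»:
# THE DIRICHLET COMPRESSION OF A `…L0` TORUS OPERATOR TO AN EMBEDDED MIRROR BOX IS THE REFLECTED FAMILY's OPERATOR ON THE BOX — hence its inverse, the Dirichlet
# Green's function of [B9] p. 394 / [4] p. 229 for ANY `…L0` family, is the pulled-back signed image sum of [Balaban1983RegularityDecay] (2.42)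

statement-level skeleton of published theorems with citation tags; proofs where landed; nothing here is a claim about the Yang–Mills mass gap

CITATION HEADER (lean-in-tree rule).  [B9] = T. Bałaban, *Propagators for lattice gauge theories in a background field*, Commun. Math. Phys. **99** (1985) 389–434
[`Balaban1985BackgroundPropagators`], p. 394 [PDF 6]: «we consider the operator Δ′_a with Dirichlet boundary conditions on ∂Ω₀, i.e. the operator Δ′_a↾Ω₀ = Ω₀Δ′_aΩ₀.
In the last expression Ω₀ denotes a characteristic function of Ω₀. Its inverse is denoted by G′, or G′(U). The operators with the boundary conditions have a very
important property. They depend on the configuration U restricted to Ω₀.»; [4] = [`Balaban1984PropagatorsII`] (2.13)–(2.14) p. 225, p. 229 («effective mass … up to +∞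
outside Ω₁»); [B4] = [`Balaban1983RegularityDecay`] (2.42) p. 584.

WHY THIS FILE (cell `pub-ymgap`, YM Track A D-0062, DAG node N06 = [B9], seat `pub-ymgap-dag-n06-c` g31; ROAD (I) «IMAGES» of LOCATED-31, file D3b).  D3a proved, on the
DOUBLED torus, `((Δ′_a of the reflected family F′)↾X)⁻¹ = (signed image kernel)↾X`.  THIS FILE brings the identity back to the ORIGINAL torus: under the FIT binder
(`n_μ + S_{k′} ≤ N₀_μ` in every mirrored direction — the closed box plus one top block fits) the embedding `emb g : X̄ → T` is injective, intertwines the torus translations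
near the open box and preserves the block relations of every kernel grid `L^j`, `j ≤ k′`, in BOTH directions; hence the rows of `F′`'s `Δ′_a` on `X × X` ARE the rows of
`F`'s `Δ′_a` on `emb X × emb X` — print's `Ω₀Δ′_aΩ₀` for `Ω₀ := emb X` — and the Dirichlet Green's function of `F`'s operator on the embedded box is the signed image sum
of the reflected torus Green's function.

WHAT IS PROVED (0 `def`; theorems; 0 sorry; 0 new named facts; standard axioms).
* §1 THE EMBEDDING NEAR THE BOX: `mirBoxOpen_subset_closed`, `coord_shift_window`, `unitVec_apply_cases`, `tshift_unit_mem_closed` (a torus neighbour of an interior site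
  lies in the closed box, with unwrapped coordinates in the mirrored directions), `emb_injOn_closed` (injective on the closed box under the fit binder), ★ `emb_tshift_unit`
  (`emb (x ± e_μ) = emb x ± e_μ` on the old torus for interior `x`).
* §2 THE GRIDS: `ediv_eq_of_emod_ediv_eq` (reduction modulo `N₀` of a window of length `N₀` with grid-aligned left end does not merge `b`-blocks, `b ∣ N₀`), ★
  `blk_eq_iff_blk_emb_eq` (sites of the closed box lie in one `L^j`-block iff their embedded images do, `j ≤ k′ + 1`).
* §3 `emb_rel_iff` (equality and `±e_μ`-adjacency read faithfully through `emb`), ★ `perLapT_emb` (the periodic Laplacians agree on interior pairs), ★★★ `mlOpT_reflected_eq_emb`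
  — for `x, y ∈ X`: `Δ′_a[F′](x, y) = Δ′_a[F](emb x, emb y)`; `compress_emb_eq` (the two compressions coincide as matrices on `X`); ★★★ `inv_compress_emb_eq_signedImK` —
  `((Δ′_a[F])|_{emb X × emb X})⁻¹ = (Σ_{ε ≤ mir} (−1)^{#ε} G′[F′](·, σ_ε ·))|_{X×X}` (weights `a_j > 0`, fit binder, margin binder of D3a), `compress_emb_mul_signedImK`,
  `isUnit_compress_emb`, `inv_compress_emb_mulVec` (the solution formula).

PROOF.  Ours (bookkeeping): the entry formula `B6MultiLevelTorusOperatorL0.mlOpT_apply` on both tori, `levR_of_mem_closed`, §1–§2, and D3a.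

HONEST SCOPE / NOT CLAIMED.  Exact linear algebra; the FIT and MARGIN binders are displayed (discharged for the cube family by the choice of `mir`, `m`, `g` in D3c); no
estimate (the (2.67)/(3.42) fold at `reflectedIdx` is D3d).  Count-neutral; N06 NOT discharged; nothing on `d = 4`, the continuum, reflection positivity, the mass gap
or Clay.  No `sorry`, no `axiom`, no `def`, no `instance`, no `notation`.  Seat `pub-ymgap-dag-n06-c` g31, 2026-08-31; `--supports stmt-QuantumFields-27239`.

RELATED IN THE TREE, NOT DUPLICATED (searched 2026-08-31, `rg` for `MirrorCompression|mlOpT_reflected_eq_emb|inv_compress_emb|blk_eq_iff_blk_emb_eq` over `lean/Literature` + `lean/Summits`: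
0 hits): D1/D2a/D2b/D3a (used by name); p33 `B6MultiLevelTorusOperatorL0.mlOpT_tshift`/`chart` (translation covariance of `Δ′_a` — other symmetry).
-/

namespace Literature.MathematicalPhysics.QuantumFieldTheory.Balaban1983to89.B6MultiLevelTorusMirrorCompression

noncomputable section

open Finset Matrix
open Literature.MathematicalPhysics.QuantumFieldTheory.Balaban1983to89.B4Reflection242 (boxDom mem_boxDom blk avgK)
open Literature.MathematicalPhysics.QuantumFieldTheory.Balaban1983to89.B4TorusKernel.MultiPeriod (torusSupNorm)
open Literature.MathematicalPhysics.QuantumFieldTheory.Balaban1983to89.B6MultiLevelBoxOperator (N0 bigSide levC one_le_bigSide)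
open Literature.MathematicalPhysics.QuantumFieldTheory.Balaban1983to89.B6MultiLevelTorusOperator (twrap twrap_mem twrap_eq_self twrap_twrap_add tshift tshift_val perLapT
  shiftMat unitVec mlOpT gmlT one_le_of_mem one_le_N0 N0_eq_bigSide_mul)
open Literature.MathematicalPhysics.QuantumFieldTheory.Balaban1983to89.B6MultiLevelTorusOperatorL0 (TDomains)
open Literature.MathematicalPhysics.QuantumFieldTheory.Balaban1983to89.B4Eq242TorusMirrors
open Literature.MathematicalPhysics.QuantumFieldTheory.Balaban1983to89.B6MultiLevelTorusMirrorL0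
open Literature.MathematicalPhysics.QuantumFieldTheory.Balaban1983to89.B6MultiLevelTorusMirrorDirichlet
open Literature.MathematicalPhysics.QuantumFieldTheory.Balaban1983to89.B4Eq242SignedImages (signedImK)

variable {d ℓ Mh k R : ℕ} {P : Fin (d + 1) → ℕ} {k' : ℕ} {mir : Fin (d + 1) → Bool} {m : Fin (d + 1) → ℕ} {g : Fin (d + 1) → ℤ}

/-! ## §1  The embedding near the box -/

section Emb

/-- the open mirror box lies in the closed one. [cite: Balaban1983RegularityDecay, (2.42) p.584, bookkeeping] -/
theorem mirBoxOpen_subset_closed {N : Fin (d + 1) → ℕ} {n h : Fin (d + 1) → ℤ} {x : ↥(boxDom N)} (hx : x ∈ mirBoxOpen N mir n h) :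
    x ∈ mirBoxClosed N mir n h := by
  rw [mirBoxOpen, Finset.mem_filter] at hx
  rw [mirBoxClosed, Finset.mem_filter]
  exact ⟨hx.1, fun μ hμ => ⟨(hx.2 μ hμ).1.le, (hx.2 μ hμ).2.le⟩⟩

/-- in a mirrored direction an interior coordinate moved by `±1` stays in `[h, h + n] ⊂ [0, N′)` (no wrap-around on the new torus).
[cite: Balaban1983RegularityDecay, (2.42) p.584, bookkeeping] -/
theorem coord_shift_window (hmir : ∀ μ, mir μ = true → (N0 ℓ Mh k' (Pref ℓ k k' P mir m) μ : ℤ) = 2 * nMir ℓ Mh k' m μ ∧ 0 ≤ hMir ℓ Mh k' ∧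
      hMir ℓ Mh k' < nMir ℓ Mh k' m μ ∧ 2 ≤ nMir ℓ Mh k' m μ)
    {x : ↥(boxDom (N0 ℓ Mh k' (Pref ℓ k k' P mir m)))}
    (hx : x ∈ mirBoxOpen (N0 ℓ Mh k' (Pref ℓ k k' P mir m)) mir (nMir ℓ Mh k' m) (fun _ => hMir ℓ Mh k'))
    {μ : Fin (d + 1)} (hμ : mir μ = true) {w : ℤ} (hw : w = 1 ∨ w = -1) :
    hMir ℓ Mh k' ≤ x.1 μ + w ∧ x.1 μ + w ≤ hMir ℓ Mh k' + nMir ℓ Mh k' m μ ∧ 0 ≤ x.1 μ + w ∧ x.1 μ + w < N0 ℓ Mh k' (Pref ℓ k k' P mir m) μ := by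
  rw [mirBoxOpen, Finset.mem_filter] at hx
  obtain ⟨hN, h0, hn, -⟩ := hmir μ hμ
  have h1 := hx.2 μ hμ
  refine ⟨by rcases hw with h | h <;> omega, by rcases hw with h | h <;> omega, by rcases hw with h | h <;> omega, ?_⟩
  have : x.1 μ + w < (N0 ℓ Mh k' (Pref ℓ k k' P mir m) μ : ℤ) := by rw [hN]; rcases hw with h | h <;> omega
  exact_mod_cast this

/-- the coordinates of `±e_μ` are `±1` at `μ` and `0` elsewhere. [cite: Balaban1983RegularityDecay, p.572, bookkeeping] -/
theorem unitVec_apply_cases (μ ν : Fin (d + 1)) :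
    (unitVec (d := d) μ ν = if ν = μ then 1 else 0) ∧ ((-unitVec (d := d) μ) ν = if ν = μ then -1 else 0) := by
  unfold unitVec
  by_cases h : ν = μ
  · subst h; simp
  · simp [h]

/-- ★ a torus neighbour (`± e_μ`) of an interior site lies in the CLOSED mirror box, and its coordinates are the plain shifted ones (no wrap in the mirrored directions).
[cite: Balaban1983RegularityDecay, (2.42) p.584, bookkeeping] -/
theorem tshift_unit_mem_closed (hmir : ∀ μ, mir μ = true → (N0 ℓ Mh k' (Pref ℓ k k' P mir m) μ : ℤ) = 2 * nMir ℓ Mh k' m μ ∧ 0 ≤ hMir ℓ Mh k' ∧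
      hMir ℓ Mh k' < nMir ℓ Mh k' m μ ∧ 2 ≤ nMir ℓ Mh k' m μ)
    {x : ↥(boxDom (N0 ℓ Mh k' (Pref ℓ k k' P mir m)))}
    (hx : x ∈ mirBoxOpen (N0 ℓ Mh k' (Pref ℓ k k' P mir m)) mir (nMir ℓ Mh k' m) (fun _ => hMir ℓ Mh k'))
    {v : Fin (d + 1) → ℤ} {μ : Fin (d + 1)} (hv : v = unitVec μ ∨ v = -unitVec μ) :
    tshift (N0 ℓ Mh k' (Pref ℓ k k' P mir m)) v x ∈ mirBoxClosed (N0 ℓ Mh k' (Pref ℓ k k' P mir m)) mir (nMir ℓ Mh k' m) (fun _ => hMir ℓ Mh k') ∧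
      ∀ ν, mir ν = true → (tshift (N0 ℓ Mh k' (Pref ℓ k k' P mir m)) v x).1 ν = x.1 ν + v ν := by
  have hvν : ∀ ν, v ν = 1 ∨ v ν = -1 ∨ v ν = 0 := by
    intro ν
    rcases hv with h | h <;> rw [h] <;> [rw [(unitVec_apply_cases μ ν).1]; rw [(unitVec_apply_cases μ ν).2]] <;> split_ifs <;> simp
  have hcoord : ∀ ν, mir ν = true → (tshift (N0 ℓ Mh k' (Pref ℓ k k' P mir m)) v x).1 ν = x.1 ν + v ν := by
    intro ν hν
    rw [tshift_val]
    show (x.1 ν + v ν) % (N0 ℓ Mh k' (Pref ℓ k k' P mir m) ν : ℤ) = x.1 ν + v ν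
    rcases hvν ν with h | h | h
    · have := coord_shift_window hmir hx hν (w := v ν) (Or.inl h)
      exact Int.emod_eq_of_lt this.2.2.1 this.2.2.2
    · have := coord_shift_window hmir hx hν (w := v ν) (Or.inr h)
      exact Int.emod_eq_of_lt this.2.2.1 this.2.2.2
    · rw [h, add_zero]
      have hb := (mem_boxDom.1 x.2) ν
      exact Int.emod_eq_of_lt hb.1 hb.2
  refine ⟨?_, hcoord⟩
  rw [mirBoxClosed, Finset.mem_filter]
  refine ⟨Finset.mem_univ _, fun ν hν => ?_⟩
  rw [hcoord ν hν]
  rcases hvν ν with h | h | h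
  · have := coord_shift_window hmir hx hν (w := v ν) (Or.inl h); exact ⟨this.1, this.2.1⟩
  · have := coord_shift_window hmir hx hν (w := v ν) (Or.inr h); exact ⟨this.1, this.2.1⟩
  · rw [h, add_zero]
    rw [mirBoxOpen, Finset.mem_filter] at hx
    exact ⟨(hx.2 ν hν).1.le, (hx.2 ν hν).2.le⟩

/-- ★ THE EMBEDDING IS INJECTIVE ON THE CLOSED BOX under the FIT binder (`n_μ + S_{k′} ≤ N₀_μ`): two sites of the closed box with the same image modulo `N₀` coincide
(their coordinates differ by less than `N₀` in every direction). [cite: Balaban1984PropagatorsII, (2.1) p.224 (the torus), bookkeeping] -/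
theorem emb_injOn_closed (hMh : 1 ≤ Mh) (hP : ∀ μ, 1 ≤ P μ) (hk : k' ≤ k)
    (hfit : ∀ μ, mir μ = true → nMir ℓ Mh k' m μ + sTop ℓ Mh k' ≤ (N0 ℓ Mh k P μ : ℤ))
    {u u' : ↥(boxDom (N0 ℓ Mh k' (Pref ℓ k k' P mir m)))}
    (hu : u ∈ mirBoxClosed (N0 ℓ Mh k' (Pref ℓ k k' P mir m)) mir (nMir ℓ Mh k' m) (fun _ => hMir ℓ Mh k'))
    (hu' : u' ∈ mirBoxClosed (N0 ℓ Mh k' (Pref ℓ k k' P mir m)) mir (nMir ℓ Mh k' m) (fun _ => hMir ℓ Mh k'))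
    (he : B6MultiLevelTorusMirrorL0.emb (ℓ := ℓ) (Mh := Mh) (k := k) (P := P) g u.1 = B6MultiLevelTorusMirrorL0.emb (ℓ := ℓ) (Mh := Mh) (k := k) (P := P) g u'.1) : u = u' := by
  rw [mirBoxClosed, Finset.mem_filter] at hu hu'
  refine Subtype.ext (funext fun μ => ?_)
  have heμ : (u.1 μ + g μ) % (N0 ℓ Mh k P μ : ℤ) = (u'.1 μ + g μ) % (N0 ℓ Mh k P μ : ℤ) := congrFun he μ
  have hN0 : (0 : ℤ) < N0 ℓ Mh k P μ := by exact_mod_cast one_le_N0 hMh hP μ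
  -- the difference is a multiple of `N₀_μ` of absolute value `< N₀_μ`
  have hdvd : (N0 ℓ Mh k P μ : ℤ) ∣ (u.1 μ + g μ) - (u'.1 μ + g μ) := Int.ModEq.dvd heμ.symm
  have hS := one_le_sTop (ℓ := ℓ) (k' := k') hMh
  have hbound : |u.1 μ - u'.1 μ| < (N0 ℓ Mh k P μ : ℤ) := by
    by_cases hm : mir μ = true
    · have h1 := hu.2 μ hm; have h2 := hu'.2 μ hm; have h3 := hfit μ hm
      rw [abs_lt]; constructor <;> linarith
    · have hb := (mem_boxDom.1 u.2) μ; have hb' := (mem_boxDom.1 u'.2) μ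
      rw [N0_Pref_of_not_mir hk hm] at hb hb'
      rw [abs_lt]; constructor <;> omega
  have : u.1 μ - u'.1 μ = 0 := by
    rw [show (u.1 μ + g μ) - (u'.1 μ + g μ) = u.1 μ - u'.1 μ by ring] at hdvd
    exact Int.eq_zero_of_abs_lt_dvd hdvd hbound
  omega

/-- ★ **THE EMBEDDING INTERTWINES THE UNIT TRANSLATIONS NEAR THE BOX**: for an interior `x`, `emb (x ± e_μ on the new torus) = (emb x) ± e_μ on the old torus`.
[cite: Balaban1983RegularityDecay, p.572 («periodic conditions»); Balaban1984PropagatorsII, (2.13) p.225 (the Laplacian rows), bookkeeping] -/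
theorem emb_tshift_unit (hMh : 1 ≤ Mh) (hP : ∀ μ, 1 ≤ P μ) (hk : k' ≤ k)
    (hmir : ∀ μ, mir μ = true → (N0 ℓ Mh k' (Pref ℓ k k' P mir m) μ : ℤ) = 2 * nMir ℓ Mh k' m μ ∧ 0 ≤ hMir ℓ Mh k' ∧
      hMir ℓ Mh k' < nMir ℓ Mh k' m μ ∧ 2 ≤ nMir ℓ Mh k' m μ)
    {x : ↥(boxDom (N0 ℓ Mh k' (Pref ℓ k k' P mir m)))}
    (hx : x ∈ mirBoxOpen (N0 ℓ Mh k' (Pref ℓ k k' P mir m)) mir (nMir ℓ Mh k' m) (fun _ => hMir ℓ Mh k'))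
    {v : Fin (d + 1) → ℤ} {μ : Fin (d + 1)} (hv : v = unitVec μ ∨ v = -unitVec μ) :
    B6MultiLevelTorusMirrorL0.emb (ℓ := ℓ) (Mh := Mh) (k := k) (P := P) g (tshift (N0 ℓ Mh k' (Pref ℓ k k' P mir m)) v x).1 =
      (tshift (N0 ℓ Mh k P) v ⟨B6MultiLevelTorusMirrorL0.emb (ℓ := ℓ) (Mh := Mh) (k := k) (P := P) g x.1, emb_mem hMh hP g x.1⟩).1 := by
  have hcoord := (tshift_unit_mem_closed hmir hx hv).2
  rw [tshift_val (N0 ℓ Mh k P)]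
  show B6MultiLevelTorusMirrorL0.emb (ℓ := ℓ) (Mh := Mh) (k := k) (P := P) g (tshift (N0 ℓ Mh k' (Pref ℓ k k' P mir m)) v x).1 =
    twrap (N0 ℓ Mh k P) (B6MultiLevelTorusMirrorL0.emb (ℓ := ℓ) (Mh := Mh) (k := k) (P := P) g x.1 + v)
  unfold B6MultiLevelTorusMirrorL0.emb
  rw [twrap_twrap_add]
  funext ν
  by_cases hν : mir ν = true
  · have h1 := hcoord ν hν
    unfold twrap
    simp only [Pi.add_apply]
    rw [h1]; congr 1; ring
  · -- non-mirrored direction: `N′_ν = N₀_ν`, reduce twice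
    rw [tshift_val]
    unfold twrap
    simp only [Pi.add_apply]
    rw [N0_Pref_of_not_mir hk hν, Int.emod_add_emod]
    congr 1; ring

end Emb

/-! ## §2  The grids under the embedding -/

section Grids

/-- reduction modulo `N₀` of a window `[c, c + N₀)` whose left end is grid-aligned does not merge `b`-blocks (`b ∣ N₀`, `b ∣ c`): equal blocks after reduction ⇒ equal
blocks before (the block indices of the window form `r = N₀/b` consecutive integers and agree modulo `r`). [cite: Balaban1984PropagatorsII, (2.1) p.224 («a sum of big blocks» on the torus), bookkeeping] -/
theorem ediv_eq_of_emod_ediv_eq {b N c t t' : ℤ} (hb : 0 < b) (hbN : b ∣ N) (hbc : b ∣ c)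
    (ht : c ≤ t ∧ t < c + N) (ht' : c ≤ t' ∧ t' < c + N) (he : (t % N) / b = (t' % N) / b) : t / b = t' / b := by
  obtain ⟨r, hr⟩ := hbN
  obtain ⟨s, hs⟩ := hbc
  have hq := Int.emod_add_mul_ediv t N
  have hq' := Int.emod_add_mul_ediv t' N
  -- block index before reduction = block index after + r·(number of wraps)
  have e1 : t / b = t % N / b + r * (t / N) := by
    have e : t = t % N + (r * (t / N)) * b := by
      rw [show r * (t / N) * b = N * (t / N) by rw [hr]; ring]; linarith
    conv_lhs => rw [e]
    rw [Int.add_mul_ediv_right _ _ hb.ne']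
  have e2 : t' / b = t' % N / b + r * (t' / N) := by
    have e : t' = t' % N + (r * (t' / N)) * b := by
      rw [show r * (t' / N) * b = N * (t' / N) by rw [hr]; ring]; linarith
    conv_lhs => rw [e]
    rw [Int.add_mul_ediv_right _ _ hb.ne']
  -- both block indices lie in the window `[s, s + r)` of `r` consecutive integers
  have hwin : ∀ u : ℤ, c ≤ u → u < c + N → s ≤ u / b ∧ u / b < s + r := by
    intro u hu1 hu2
    constructor
    · have := Int.ediv_le_ediv hb hu1
      rwa [hs, show b * s = s * b by ring, Int.mul_ediv_cancel _ hb.ne'] at this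
    · rw [Int.ediv_lt_iff_lt_mul hb]
      calc u < c + N := hu2
        _ = (s + r) * b := by rw [hs, hr]; ring
  have h1 := hwin t ht.1 ht.2
  have h2 := hwin t' ht'.1 ht'.2
  -- and they are congruent modulo `r`
  have hdvd : r ∣ t / b - t' / b := ⟨t / N - t' / N, by rw [e1, e2, he]; ring⟩
  have habs : |t / b - t' / b| < r := by rw [abs_lt]; constructor <;> omega
  have := Int.eq_zero_of_abs_lt_dvd hdvd habs
  omega

/-- ★ **SITES OF THE CLOSED BOX LIE IN ONE `L^j`-BLOCK IFF THEIR EMBEDDED IMAGES DO** (`j ≤ k′ + 1`, fit binder): the block relation of every averaging kernel is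
transported faithfully. [cite: Balaban1984PropagatorsII, (2.14) p.225, (2.1) p.224, bookkeeping] -/
theorem blk_eq_iff_blk_emb_eq (hL : Odd (ℓ + 1)) (hM : Odd Mh) (hMh : 1 ≤ Mh) (hP : ∀ μ, 1 ≤ P μ) (hk : k' ≤ k)
    (hm : ∀ μ, mir μ = true → 2 ≤ m μ) (hg : ∀ μ, sTop ℓ Mh k' ∣ g μ)
    (hfit : ∀ μ, mir μ = true → nMir ℓ Mh k' m μ + sTop ℓ Mh k' ≤ (N0 ℓ Mh k P μ : ℤ))
    {j : ℕ} (hj : j ≤ k' + 1)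
    {u u' : ↥(boxDom (N0 ℓ Mh k' (Pref ℓ k k' P mir m)))}
    (hu : u ∈ mirBoxClosed (N0 ℓ Mh k' (Pref ℓ k k' P mir m)) mir (nMir ℓ Mh k' m) (fun _ => hMir ℓ Mh k'))
    (hu' : u' ∈ mirBoxClosed (N0 ℓ Mh k' (Pref ℓ k k' P mir m)) mir (nMir ℓ Mh k' m) (fun _ => hMir ℓ Mh k')) :
    blk ((ℓ + 1) ^ j) u.1 = blk ((ℓ + 1) ^ j) u'.1 ↔
      blk ((ℓ + 1) ^ j) (B6MultiLevelTorusMirrorL0.emb (ℓ := ℓ) (Mh := Mh) (k := k) (P := P) g u.1) = blk ((ℓ + 1) ^ j) (B6MultiLevelTorusMirrorL0.emb (ℓ := ℓ) (Mh := Mh) (k := k) (P := P) g u'.1) := by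
  have hS : 0 < (ℓ + 1) ^ j := Nat.pow_pos (Nat.succ_pos ℓ)
  have hdvdS : (((ℓ + 1) ^ j : ℕ) : ℤ) ∣ sTop ℓ Mh k' := by
    unfold sTop bigSide; push_cast
    rw [show ((Mh : ℤ) * ((ℓ : ℤ) + 1) ^ (k' + 1)) = ((ℓ : ℤ) + 1) ^ j * ((Mh : ℤ) * ((ℓ : ℤ) + 1) ^ (k' + 1 - j)) by
      rw [mul_left_comm, ← pow_add]; congr 2; omega]
    exact Dvd.intro _ rfl
  have hdvdN : ∀ μ, (((ℓ + 1) ^ j : ℕ) : ℤ) ∣ (N0 ℓ Mh k P μ : ℤ) := fun μ => by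
    rw [N0_eq_bigSide_mul]; unfold bigSide; push_cast
    rw [show ((Mh : ℤ) * ((ℓ : ℤ) + 1) ^ (k + 1)) * (P μ : ℤ) = ((ℓ : ℤ) + 1) ^ j * ((Mh : ℤ) * ((ℓ : ℤ) + 1) ^ (k + 1 - j) * (P μ : ℤ)) by
      rw [show ((Mh : ℤ) * ((ℓ : ℤ) + 1) ^ (k + 1)) = ((ℓ : ℤ) + 1) ^ j * ((Mh : ℤ) * ((ℓ : ℤ) + 1) ^ (k + 1 - j)) by
        rw [mul_left_comm, ← pow_add]; congr 2; omega]; ring]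
    exact Dvd.intro _ rfl
  constructor
  · exact fun h => blk_emb_eq_of_blk_eq hMh hP hS (fun μ => hdvdS.trans (hg μ)) hdvdN h
  · intro h
    funext μ
    have hμ : (B6MultiLevelTorusMirrorL0.emb (ℓ := ℓ) (Mh := Mh) (k := k) (P := P) g u.1) μ / ((((ℓ + 1) ^ j : ℕ)) : ℤ) =
        (B6MultiLevelTorusMirrorL0.emb (ℓ := ℓ) (Mh := Mh) (k := k) (P := P) g u'.1) μ / ((((ℓ + 1) ^ j : ℕ)) : ℤ) := congrFun h μ
    unfold B6MultiLevelTorusMirrorL0.emb twrap at hμ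
    simp only [Pi.add_apply] at hμ
    have hN0 : (0 : ℤ) < N0 ℓ Mh k P μ := by exact_mod_cast one_le_N0 hMh hP μ
    rw [mirBoxClosed, Finset.mem_filter] at hu hu'
    show u.1 μ / ((((ℓ + 1) ^ j : ℕ)) : ℤ) = u'.1 μ / ((((ℓ + 1) ^ j : ℕ)) : ℤ)
    -- the window `[g_μ, g_μ + N₀)` contains both shifted coordinates
    have hwin : ∀ w : ↥(boxDom (N0 ℓ Mh k' (Pref ℓ k k' P mir m))),
        w ∈ mirBoxClosed (N0 ℓ Mh k' (Pref ℓ k k' P mir m)) mir (nMir ℓ Mh k' m) (fun _ => hMir ℓ Mh k') →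
        g μ ≤ w.1 μ + g μ ∧ w.1 μ + g μ < g μ + N0 ℓ Mh k P μ := by
      intro w hw
      rw [mirBoxClosed, Finset.mem_filter] at hw
      have hb := (mem_boxDom.1 w.2) μ
      by_cases hmμ : mir μ = true
      · obtain ⟨-, h0, hn, -⟩ := hmir_of_top (k := k) (k' := k') (P := P) (mir := mir) (m := m) hL hM hMh hm μ hmμ
        have h1 := hw.2 μ hmμ; have h3 := hfit μ hmμ
        have hS1 := one_le_sTop (ℓ := ℓ) (k' := k') hMh
        have h2 := two_mul_hMir_add_one (k' := k') hL hM
        constructor <;> linarith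
      · rw [N0_Pref_of_not_mir hk hmμ] at hb
        constructor <;> omega
    have h1 := hwin u (by rw [mirBoxClosed, Finset.mem_filter]; exact hu)
    have h2 := hwin u' (by rw [mirBoxClosed, Finset.mem_filter]; exact hu')
    have key := ediv_eq_of_emod_ediv_eq (by exact_mod_cast hS) (hdvdN μ) (hdvdS.trans (hg μ)) h1 h2 hμ
    -- remove the shift `g_μ` (a multiple of the block side)
    obtain ⟨q, hq⟩ := hdvdS.trans (hg μ)
    have hS' : ((((ℓ + 1) ^ j : ℕ)) : ℤ) ≠ 0 := by exact_mod_cast hS.ne'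
    rw [hq, show (u.1 μ + (((ℓ + 1) ^ j : ℕ) : ℤ) * q) = u.1 μ + q * (((ℓ + 1) ^ j : ℕ) : ℤ) by ring,
      show (u'.1 μ + (((ℓ + 1) ^ j : ℕ) : ℤ) * q) = u'.1 μ + q * (((ℓ + 1) ^ j : ℕ) : ℤ) by ring,
      Int.add_mul_ediv_right _ _ hS', Int.add_mul_ediv_right _ _ hS'] at key
    omega

end Grids

/-! ## §3  The rows of the two operators agree on the box; the Dirichlet Green's function of `F` on the embedded box -/

section Rows

/-- equality and adjacency on the box are read faithfully through the embedding (interior sites, fit binder).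
[cite: Balaban1983RegularityDecay, p.572; Balaban1984PropagatorsII, (2.13) p.225, bookkeeping] -/
theorem emb_rel_iff (hL : Odd (ℓ + 1)) (hM : Odd Mh) (hMh : 1 ≤ Mh) (hP : ∀ μ, 1 ≤ P μ) (hk : k' ≤ k)
    (hm : ∀ μ, mir μ = true → 2 ≤ m μ) (hfit : ∀ μ, mir μ = true → nMir ℓ Mh k' m μ + sTop ℓ Mh k' ≤ (N0 ℓ Mh k P μ : ℤ))
    {x y : ↥(boxDom (N0 ℓ Mh k' (Pref ℓ k k' P mir m)))}
    (hx : x ∈ mirBoxOpen (N0 ℓ Mh k' (Pref ℓ k k' P mir m)) mir (nMir ℓ Mh k' m) (fun _ => hMir ℓ Mh k'))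
    (hy : y ∈ mirBoxOpen (N0 ℓ Mh k' (Pref ℓ k k' P mir m)) mir (nMir ℓ Mh k' m) (fun _ => hMir ℓ Mh k'))
    {v : Fin (d + 1) → ℤ} {μ : Fin (d + 1)} (hv : v = unitVec μ ∨ v = -unitVec μ) :
    (x = y ↔ (⟨B6MultiLevelTorusMirrorL0.emb (ℓ := ℓ) (Mh := Mh) (k := k) (P := P) g x.1, emb_mem hMh hP g x.1⟩ : ↥(boxDom (N0 ℓ Mh k P))) = (⟨B6MultiLevelTorusMirrorL0.emb (ℓ := ℓ) (Mh := Mh) (k := k) (P := P) g y.1, emb_mem hMh hP g y.1⟩ : ↥(boxDom (N0 ℓ Mh k P)))) ∧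
    (y = tshift (N0 ℓ Mh k' (Pref ℓ k k' P mir m)) v x ↔ (⟨B6MultiLevelTorusMirrorL0.emb (ℓ := ℓ) (Mh := Mh) (k := k) (P := P) g y.1, emb_mem hMh hP g y.1⟩ : ↥(boxDom (N0 ℓ Mh k P))) = tshift (N0 ℓ Mh k P) v (⟨B6MultiLevelTorusMirrorL0.emb (ℓ := ℓ) (Mh := Mh) (k := k) (P := P) g x.1, emb_mem hMh hP g x.1⟩ : ↥(boxDom (N0 ℓ Mh k P)))) := by
  have hinj := fun (u u' : ↥(boxDom (N0 ℓ Mh k' (Pref ℓ k k' P mir m)))) (hu : u ∈ mirBoxClosed (N0 ℓ Mh k' (Pref ℓ k k' P mir m)) mir (nMir ℓ Mh k' m) (fun _ => hMir ℓ Mh k'))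
    (hu' : u' ∈ mirBoxClosed (N0 ℓ Mh k' (Pref ℓ k k' P mir m)) mir (nMir ℓ Mh k' m) (fun _ => hMir ℓ Mh k')) =>
    emb_injOn_closed (ℓ := ℓ) (Mh := Mh) (k := k) (P := P) (g := g) hMh hP hk hfit hu hu'
  constructor
  · constructor
    · intro h; subst h; rfl
    · intro h
      exact hinj x y (mirBoxOpen_subset_closed hx) (mirBoxOpen_subset_closed hy) (congrArg Subtype.val h)
  · have hshift := emb_tshift_unit (g := g) hMh hP hk (hmir_of_top (k := k) (P := P) hL hM hMh hm) hx hv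
    constructor
    · intro h; subst h
      exact Subtype.ext hshift
    · intro h
      have h' : B6MultiLevelTorusMirrorL0.emb (ℓ := ℓ) (Mh := Mh) (k := k) (P := P) g y.1 = B6MultiLevelTorusMirrorL0.emb (ℓ := ℓ) (Mh := Mh) (k := k) (P := P) g (tshift (N0 ℓ Mh k' (Pref ℓ k k' P mir m)) v x).1 := by
        rw [hshift]; exact congrArg Subtype.val h
      exact hinj y _ (mirBoxOpen_subset_closed hy) (tshift_unit_mem_closed (hmir_of_top (k := k) (P := P) hL hM hMh hm) hx hv).1 h'

/-- ★ the periodic Laplacians agree: `(−Δ^{per}_{N′})(x, y) = (−Δ^{per}_{N₀})(emb x, emb y)` for interior `x, y` (fit binder).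
[cite: Balaban1983RegularityDecay, (1.3) p.572 («periodic conditions»); Balaban1984PropagatorsII, (2.13) p.225] -/
theorem perLapT_emb (hL : Odd (ℓ + 1)) (hM : Odd Mh) (hMh : 1 ≤ Mh) (hP : ∀ μ, 1 ≤ P μ) (hk : k' ≤ k)
    (hm : ∀ μ, mir μ = true → 2 ≤ m μ) (hfit : ∀ μ, mir μ = true → nMir ℓ Mh k' m μ + sTop ℓ Mh k' ≤ (N0 ℓ Mh k P μ : ℤ))
    {x y : ↥(boxDom (N0 ℓ Mh k' (Pref ℓ k k' P mir m)))}
    (hx : x ∈ mirBoxOpen (N0 ℓ Mh k' (Pref ℓ k k' P mir m)) mir (nMir ℓ Mh k' m) (fun _ => hMir ℓ Mh k'))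
    (hy : y ∈ mirBoxOpen (N0 ℓ Mh k' (Pref ℓ k k' P mir m)) mir (nMir ℓ Mh k' m) (fun _ => hMir ℓ Mh k')) :
    perLapT (N0 ℓ Mh k' (Pref ℓ k k' P mir m)) x y = perLapT (N0 ℓ Mh k P) (⟨B6MultiLevelTorusMirrorL0.emb (ℓ := ℓ) (Mh := Mh) (k := k) (P := P) g x.1, emb_mem hMh hP g x.1⟩ : ↥(boxDom (N0 ℓ Mh k P))) (⟨B6MultiLevelTorusMirrorL0.emb (ℓ := ℓ) (Mh := Mh) (k := k) (P := P) g y.1, emb_mem hMh hP g y.1⟩ : ↥(boxDom (N0 ℓ Mh k P))) := by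
  unfold perLapT shiftMat
  simp only [Matrix.sum_apply, Matrix.sub_apply, Matrix.smul_apply, Matrix.one_apply, smul_eq_mul]
  refine Finset.sum_congr rfl fun μ _ => ?_
  have h0 := (emb_rel_iff (g := g) hL hM hMh hP hk hm hfit hx hy (v := unitVec μ) (μ := μ) (Or.inl rfl)).1
  have h1 := (emb_rel_iff (g := g) hL hM hMh hP hk hm hfit hx hy (v := unitVec μ) (μ := μ) (Or.inl rfl)).2
  have h2 := (emb_rel_iff (g := g) hL hM hMh hP hk hm hfit hx hy (v := -unitVec μ) (μ := μ) (Or.inr rfl)).2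
  have e0 : (if x = y then (1 : ℝ) else 0) = (if (⟨B6MultiLevelTorusMirrorL0.emb (ℓ := ℓ) (Mh := Mh) (k := k) (P := P) g x.1, emb_mem hMh hP g x.1⟩ : ↥(boxDom (N0 ℓ Mh k P))) = (⟨B6MultiLevelTorusMirrorL0.emb (ℓ := ℓ) (Mh := Mh) (k := k) (P := P) g y.1, emb_mem hMh hP g y.1⟩ : ↥(boxDom (N0 ℓ Mh k P))) then (1 : ℝ) else 0) := by
    by_cases h : x = y
    · rw [if_pos h, if_pos (h0.1 h)]
    · rw [if_neg h, if_neg (fun h' => h (h0.2 h'))]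
  have e1 : (if y = tshift (N0 ℓ Mh k' (Pref ℓ k k' P mir m)) (unitVec μ) x then (1 : ℝ) else 0) =
      (if (⟨B6MultiLevelTorusMirrorL0.emb (ℓ := ℓ) (Mh := Mh) (k := k) (P := P) g y.1, emb_mem hMh hP g y.1⟩ : ↥(boxDom (N0 ℓ Mh k P))) = tshift (N0 ℓ Mh k P) (unitVec μ) (⟨B6MultiLevelTorusMirrorL0.emb (ℓ := ℓ) (Mh := Mh) (k := k) (P := P) g x.1, emb_mem hMh hP g x.1⟩ : ↥(boxDom (N0 ℓ Mh k P))) then (1 : ℝ) else 0) := by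
    by_cases h : y = tshift (N0 ℓ Mh k' (Pref ℓ k k' P mir m)) (unitVec μ) x
    · rw [if_pos h, if_pos (h1.1 h)]
    · rw [if_neg h, if_neg (fun h' => h (h1.2 h'))]
  have e2 : (if y = tshift (N0 ℓ Mh k' (Pref ℓ k k' P mir m)) (-unitVec μ) x then (1 : ℝ) else 0) =
      (if (⟨B6MultiLevelTorusMirrorL0.emb (ℓ := ℓ) (Mh := Mh) (k := k) (P := P) g y.1, emb_mem hMh hP g y.1⟩ : ↥(boxDom (N0 ℓ Mh k P))) = tshift (N0 ℓ Mh k P) (-unitVec μ) (⟨B6MultiLevelTorusMirrorL0.emb (ℓ := ℓ) (Mh := Mh) (k := k) (P := P) g x.1, emb_mem hMh hP g x.1⟩ : ↥(boxDom (N0 ℓ Mh k P))) then (1 : ℝ) else 0) := by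
    by_cases h : y = tshift (N0 ℓ Mh k' (Pref ℓ k k' P mir m)) (-unitVec μ) x
    · rw [if_pos h, if_pos (h2.1 h)]
    · rw [if_neg h, if_neg (fun h' => h (h2.2 h'))]
  rw [e0, e1, e2]

/-- ★★★ **THE ROWS AGREE**: for interior `x, y` the entry `Δ′_a[F′](x, y)` of the reflected family's torus operator IS the entry `Δ′_a[F](emb x, emb y)` of `F`'s torus
operator — the reflected family restricted to the box is print's `Ω₀Δ′_aΩ₀` with `Ω₀ = emb X` (fit binder). [cite: Balaban1985BackgroundPropagators, p.394 («Δ′_a↾Ω₀ = Ω₀Δ′_aΩ₀»); Balaban1984PropagatorsII, (2.13)–(2.14) p.225] -/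
theorem mlOpT_reflected_eq_emb {F : TDomains d ℓ Mh k P R}
    {hL : Odd (ℓ + 1)} {hM : Odd Mh} {hMh : 1 ≤ Mh} {hP : ∀ μ, 1 ≤ P μ} {hk : k' ≤ k} {hlev : ∀ x, F.lev x ≤ k'}
    {hm : ∀ μ, mir μ = true → 2 ≤ m μ} {hg : ∀ μ, sTop ℓ Mh k' ∣ g μ} (hfit : ∀ μ, mir μ = true → nMir ℓ Mh k' m μ + sTop ℓ Mh k' ≤ (N0 ℓ Mh k P μ : ℤ)) (a : ℕ → ℝ)
    {x y : ↥(boxDom (N0 ℓ Mh k' (Pref ℓ k k' P mir m)))}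
    (hx : x ∈ mirBoxOpen (N0 ℓ Mh k' (Pref ℓ k k' P mir m)) mir (nMir ℓ Mh k' m) (fun _ => hMir ℓ Mh k'))
    (hy : y ∈ mirBoxOpen (N0 ℓ Mh k' (Pref ℓ k k' P mir m)) mir (nMir ℓ Mh k' m) (fun _ => hMir ℓ Mh k')) :
    mlOpT (N0 ℓ Mh k' (Pref ℓ k k' P mir m)) ℓ k' (reflected F k' mir m g hL hM hMh hP hk hlev hm hg).lev a x y = mlOpT (N0 ℓ Mh k P) ℓ k F.lev a (⟨B6MultiLevelTorusMirrorL0.emb (ℓ := ℓ) (Mh := Mh) (k := k) (P := P) g x.1, emb_mem hMh hP g x.1⟩ : ↥(boxDom (N0 ℓ Mh k P))) (⟨B6MultiLevelTorusMirrorL0.emb (ℓ := ℓ) (Mh := Mh) (k := k) (P := P) g y.1, emb_mem hMh hP g y.1⟩ : ↥(boxDom (N0 ℓ Mh k P))) := by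
  rw [B6MultiLevelTorusOperatorL0.mlOpT_apply (reflected F k' mir m g hL hM hMh hP hk hlev hm hg) rfl a, B6MultiLevelTorusOperatorL0.mlOpT_apply F rfl a, reflected_lev,
    levR_of_mem_closed (mirBoxOpen_subset_closed hx), perLapT_emb hL hM hMh hP hk hm hfit hx hy]
  congr 1
  have hj : F.lev (B6MultiLevelTorusMirrorL0.emb (ℓ := ℓ) (Mh := Mh) (k := k) (P := P) g x.1) ≤ k' + 1 := (hlev _).trans (Nat.le_succ _)
  have key := blk_eq_iff_blk_emb_eq (g := g) hL hM hMh hP hk hm hg hfit hj (mirBoxOpen_subset_closed hy) (mirBoxOpen_subset_closed hx)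
  unfold avgK
  by_cases hb : blk ((ℓ + 1) ^ F.lev (B6MultiLevelTorusMirrorL0.emb (ℓ := ℓ) (Mh := Mh) (k := k) (P := P) g x.1)) y.1 = blk ((ℓ + 1) ^ F.lev (B6MultiLevelTorusMirrorL0.emb (ℓ := ℓ) (Mh := Mh) (k := k) (P := P) g x.1)) x.1
  · rw [if_pos hb, if_pos (key.1 hb)]
  · rw [if_neg hb, if_neg (fun h => hb (key.2 h))]

/-- ★ THE TWO COMPRESSIONS COINCIDE as matrices on the box: `(Δ′_a[F])|_{emb X × emb X} = (Δ′_a[F′])|_{X × X}`.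
[cite: Balaban1985BackgroundPropagators, p.394; Balaban1984PropagatorsII, (2.13)–(2.14) p.225] -/
theorem compress_emb_eq {F : TDomains d ℓ Mh k P R}
    (hL : Odd (ℓ + 1)) (hM : Odd Mh) (hMh : 1 ≤ Mh) (hP : ∀ μ, 1 ≤ P μ) (hk : k' ≤ k) (hlev : ∀ x, F.lev x ≤ k')
    (hm : ∀ μ, mir μ = true → 2 ≤ m μ) (hg : ∀ μ, sTop ℓ Mh k' ∣ g μ) (hfit : ∀ μ, mir μ = true → nMir ℓ Mh k' m μ + sTop ℓ Mh k' ≤ (N0 ℓ Mh k P μ : ℤ)) (a : ℕ → ℝ) :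
    (mlOpT (N0 ℓ Mh k P) ℓ k F.lev a).submatrix (fun v : ↥(mirBoxOpen (N0 ℓ Mh k' (Pref ℓ k k' P mir m)) mir (nMir ℓ Mh k' m) (fun _ => hMir ℓ Mh k')) => (⟨B6MultiLevelTorusMirrorL0.emb (ℓ := ℓ) (Mh := Mh) (k := k) (P := P) g v.1.1, emb_mem hMh hP g v.1.1⟩ : ↥(boxDom (N0 ℓ Mh k P)))) (fun v : ↥(mirBoxOpen (N0 ℓ Mh k' (Pref ℓ k k' P mir m)) mir (nMir ℓ Mh k' m) (fun _ => hMir ℓ Mh k')) => (⟨B6MultiLevelTorusMirrorL0.emb (ℓ := ℓ) (Mh := Mh) (k := k) (P := P) g v.1.1, emb_mem hMh hP g v.1.1⟩ : ↥(boxDom (N0 ℓ Mh k P)))) = (mlOpT (N0 ℓ Mh k' (Pref ℓ k k' P mir m)) ℓ k' (reflected F k' mir m g hL hM hMh hP hk hlev hm hg).lev a).submatrix (fun v : ↥(mirBoxOpen (N0 ℓ Mh k' (Pref ℓ k k' P mir m)) mir (nMir ℓ Mh k' m) (fun _ => hMir ℓ Mh k')) => v.1) (fun v : ↥(mirBoxOpen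 (N0 ℓ Mh k' (Pref ℓ k k' P mir m)) mir (nMir ℓ Mh k' m) (fun _ => hMir ℓ Mh k')) => v.1) := by
  ext x y
  simp only [Matrix.submatrix_apply]
  exact (mlOpT_reflected_eq_emb (hL := hL) (hM := hM) (hMh := hMh) (hP := hP) (hk := hk) (hlev := hlev) (hm := hm) (hg := hg) hfit a x.2 y.2).symm

/-- ★★★ **THE DIRICHLET GREEN's FUNCTION OF `F`'s OPERATOR ON THE EMBEDDED MIRROR BOX** `Ω₀ = emb X` — the inverse of print's `Ω₀Δ′_aΩ₀` — IS THE PULLED-BACK SIGNED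
IMAGE SUM of the reflected torus Green's function: `((Δ′_a[F])|_{emb X×emb X})⁻¹ = (Σ_{ε ≤ mir} (−1)^{#ε} G′[F′](·, σ_ε ·))|_{X×X}` (weights `a_j > 0`; fit and margin
binders). [cite: Balaban1985BackgroundPropagators, p.394 («Its inverse is denoted by G′»); Balaban1984PropagatorsII, p.229; Balaban1983RegularityDecay, (2.42) p.584] -/
theorem inv_compress_emb_eq_signedImK {F : TDomains d ℓ Mh k P R}
    {hL : Odd (ℓ + 1)} {hM : Odd Mh} {hMh : 1 ≤ Mh} {hP : ∀ μ, 1 ≤ P μ} {hk : k' ≤ k} {hlev : ∀ x, F.lev x ≤ k'}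
    {hm : ∀ μ, mir μ = true → 2 ≤ m μ} {hg : ∀ μ, sTop ℓ Mh k' ∣ g μ} (hfit : ∀ μ, mir μ = true → nMir ℓ Mh k' m μ + sTop ℓ Mh k' ≤ (N0 ℓ Mh k P μ : ℤ)) (a : ℕ → ℝ) (ha : ∀ j, 0 < a j)
    (hmarg : ∀ x : ↥(boxDom (N0 ℓ Mh k' (Pref ℓ k k' P mir m))),
      x ∈ mirBoxOpen (N0 ℓ Mh k' (Pref ℓ k k' P mir m)) mir (nMir ℓ Mh k' m) (fun _ => hMir ℓ Mh k') →
      ∀ z : ↥(boxDom (N0 ℓ Mh k' (Pref ℓ k k' P mir m))),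
        blk ((ℓ + 1) ^ (reflected F k' mir m g hL hM hMh hP hk hlev hm hg).lev x.1) z.1 = blk ((ℓ + 1) ^ (reflected F k' mir m g hL hM hMh hP hk hlev hm hg).lev x.1) x.1 →
        z ∈ mirBoxOpen (N0 ℓ Mh k' (Pref ℓ k k' P mir m)) mir (nMir ℓ Mh k' m) (fun _ => hMir ℓ Mh k')) :
    ((mlOpT (N0 ℓ Mh k P) ℓ k F.lev a).submatrix (fun v : ↥(mirBoxOpen (N0 ℓ Mh k' (Pref ℓ k k' P mir m)) mir (nMir ℓ Mh k' m) (fun _ => hMir ℓ Mh k')) => (⟨B6MultiLevelTorusMirrorL0.emb (ℓ := ℓ) (Mh := Mh) (k := k) (P := P) g v.1.1, emb_mem hMh hP g v.1.1⟩ : ↥(boxDom (N0 ℓ Mh k P)))) (fun v : ↥(mirBoxOpen (N0 ℓ Mh k' (Pref ℓ k k' P mir m)) mir (nMir ℓ Mh k' m) (fun _ => hMir ℓ Mh k')) => (⟨B6MultiLevelTorusMirrorL0.emb (ℓ := ℓ) (Mh := Mh) (k := k) (P := P) g v.1.1, emb_mem hMh hP g v.1.1⟩ : ↥(boxDom (N0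 ℓ Mh k P)))))⁻¹ = (signedImK (mirIdx mir) (trefl (hmir_of_top (k := k) (P := P) hL hM hMh hm)) (tsign ℝ mir) (gmlT (N0 ℓ Mh k' (Pref ℓ k k' P mir m)) ℓ k' (reflected F k' mir m g hL hM hMh hP hk hlev hm hg).lev a)).submatrix (fun v : ↥(mirBoxOpen (N0 ℓ Mh k' (Pref ℓ k k' P mir m)) mir (nMir ℓ Mh k' m) (fun _ => hMir ℓ Mh k')) => v.1) (fun v : ↥(mirBoxOpen (N0 ℓ Mh k' (Pref ℓ k k' P mir m)) mir (nMir ℓ Mh k' m) (fun _ => hMir ℓ Mh k')) => v.1) := by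
  rw [compress_emb_eq hL hM hMh hP hk hlev hm hg hfit a]
  exact inv_compress_mlOpT_eq_signedImK a ha hmarg

/-- the compressed operator times the pulled-back signed image kernel is `1`. [cite: Balaban1985BackgroundPropagators, p.394; Balaban1983RegularityDecay, (2.42) p.584] -/
theorem compress_emb_mul_signedImK {F : TDomains d ℓ Mh k P R}
    {hL : Odd (ℓ + 1)} {hM : Odd Mh} {hMh : 1 ≤ Mh} {hP : ∀ μ, 1 ≤ P μ} {hk : k' ≤ k} {hlev : ∀ x, F.lev x ≤ k'}
    {hm : ∀ μ, mir μ = true → 2 ≤ m μ} {hg : ∀ μ, sTop ℓ Mh k' ∣ g μ} (hfit : ∀ μ, mir μ = true → nMir ℓ Mh k' m μ + sTop ℓ Mh k' ≤ (N0 ℓ Mh k P μ : ℤ)) (a : ℕ → ℝ) (ha : ∀ j, 0 < a j)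
    (hmarg : ∀ x : ↥(boxDom (N0 ℓ Mh k' (Pref ℓ k k' P mir m))),
      x ∈ mirBoxOpen (N0 ℓ Mh k' (Pref ℓ k k' P mir m)) mir (nMir ℓ Mh k' m) (fun _ => hMir ℓ Mh k') →
      ∀ z : ↥(boxDom (N0 ℓ Mh k' (Pref ℓ k k' P mir m))),
        blk ((ℓ + 1) ^ (reflected F k' mir m g hL hM hMh hP hk hlev hm hg).lev x.1) z.1 = blk ((ℓ + 1) ^ (reflected F k' mir m g hL hM hMh hP hk hlev hm hg).lev x.1) x.1 →
        z ∈ mirBoxOpen (N0 ℓ Mh k' (Pref ℓ k k' P mir m)) mir (nMir ℓ Mh k' m) (fun _ => hMir ℓ Mh k')) :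
    (mlOpT (N0 ℓ Mh k P) ℓ k F.lev a).submatrix (fun v : ↥(mirBoxOpen (N0 ℓ Mh k' (Pref ℓ k k' P mir m)) mir (nMir ℓ Mh k' m) (fun _ => hMir ℓ Mh k')) => (⟨B6MultiLevelTorusMirrorL0.emb (ℓ := ℓ) (Mh := Mh) (k := k) (P := P) g v.1.1, emb_mem hMh hP g v.1.1⟩ : ↥(boxDom (N0 ℓ Mh k P)))) (fun v : ↥(mirBoxOpen (N0 ℓ Mh k' (Pref ℓ k k' P mir m)) mir (nMir ℓ Mh k' m) (fun _ => hMir ℓ Mh k')) => (⟨B6MultiLevelTorusMirrorL0.emb (ℓ := ℓ) (Mh := Mh) (k := k) (P := P) g v.1.1, emb_mem hMh hP g v.1.1⟩ : ↥(boxDom (N0 ℓ Mh k P)))) * (signedImK (mirIdx mir) (trefl (hmir_of_top (k := k) (P := P) hL hM hMh hm)) (tsign ℝ mir) (gmlT (N0 ℓ Mh k' (Pref ℓ k k' P mir m)) ℓ k' (reflected F k' mir m g hL hM hMh hP hk hlev hm hg).lev a)).submatrix (fun v : ↥(mirBoxOpen (N0 ℓ Mh k' (Pref ℓ k k' P mir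 m)) mir (nMir ℓ Mh k' m) (fun _ => hMir ℓ Mh k')) => v.1) (fun v : ↥(mirBoxOpen (N0 ℓ Mh k' (Pref ℓ k k' P mir m)) mir (nMir ℓ Mh k' m) (fun _ => hMir ℓ Mh k')) => v.1) = 1 := by
  rw [compress_emb_eq hL hM hMh hP hk hlev hm hg hfit a]
  exact compress_mlOpT_mul_signedImK a ha hmarg

/-- ★ «G′ = (Ω₀Δ′_aΩ₀)⁻¹ exists»: the Dirichlet compression of `F`'s operator to the embedded box is invertible. [cite: Balaban1985BackgroundPropagators, p.394; Balaban1984PropagatorsII, p.225] -/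
theorem isUnit_compress_emb {F : TDomains d ℓ Mh k P R}
    {hL : Odd (ℓ + 1)} {hM : Odd Mh} {hMh : 1 ≤ Mh} {hP : ∀ μ, 1 ≤ P μ} {hk : k' ≤ k} {hlev : ∀ x, F.lev x ≤ k'}
    {hm : ∀ μ, mir μ = true → 2 ≤ m μ} {hg : ∀ μ, sTop ℓ Mh k' ∣ g μ} (hfit : ∀ μ, mir μ = true → nMir ℓ Mh k' m μ + sTop ℓ Mh k' ≤ (N0 ℓ Mh k P μ : ℤ)) (a : ℕ → ℝ) (ha : ∀ j, 0 < a j)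
    (hmarg : ∀ x : ↥(boxDom (N0 ℓ Mh k' (Pref ℓ k k' P mir m))),
      x ∈ mirBoxOpen (N0 ℓ Mh k' (Pref ℓ k k' P mir m)) mir (nMir ℓ Mh k' m) (fun _ => hMir ℓ Mh k') →
      ∀ z : ↥(boxDom (N0 ℓ Mh k' (Pref ℓ k k' P mir m))),
        blk ((ℓ + 1) ^ (reflected F k' mir m g hL hM hMh hP hk hlev hm hg).lev x.1) z.1 = blk ((ℓ + 1) ^ (reflected F k' mir m g hL hM hMh hP hk hlev hm hg).lev x.1) x.1 →
        z ∈ mirBoxOpen (N0 ℓ Mh k' (Pref ℓ k k' P mir m)) mir (nMir ℓ Mh k' m) (fun _ => hMir ℓ Mh k')) :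
    IsUnit ((mlOpT (N0 ℓ Mh k P) ℓ k F.lev a).submatrix (fun v : ↥(mirBoxOpen (N0 ℓ Mh k' (Pref ℓ k k' P mir m)) mir (nMir ℓ Mh k' m) (fun _ => hMir ℓ Mh k')) => (⟨B6MultiLevelTorusMirrorL0.emb (ℓ := ℓ) (Mh := Mh) (k := k) (P := P) g v.1.1, emb_mem hMh hP g v.1.1⟩ : ↥(boxDom (N0 ℓ Mh k P)))) (fun v : ↥(mirBoxOpen (N0 ℓ Mh k' (Pref ℓ k k' P mir m)) mir (nMir ℓ Mh k' m) (fun _ => hMir ℓ Mh k')) => (⟨B6MultiLevelTorusMirrorL0.emb (ℓ := ℓ) (Mh := Mh) (k := k) (P := P) g v.1.1, emb_mem hMh hP g v.1.1⟩ : ↥(boxDom (N0 ℓ Mh k P))))) := by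
  rw [compress_emb_eq hL hM hMh hP hk hlev hm hg hfit a]
  exact isUnit_compress_mlOpT a ha hmarg


/-- ★ **THE DIRICHLET SOLUTION FORMULA ON THE EMBEDDED BOX**: `((Ω₀Δ′_a[F]Ω₀)⁻¹ f)(x) = Σ_{y∈X} Σ_{ε ≤ mir} (−1)^{#ε} G′[F′](x, σ_ε y) f(y)` (the unknowns indexed by the
new box `X`, `Ω₀ = emb X`). [cite: Balaban1985BackgroundPropagators, p.394 (the Dirichlet inverse G′); Balaban1983RegularityDecay, (2.42) p.584] -/
theorem inv_compress_emb_mulVec {F : TDomains d ℓ Mh k P R}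
    {hL : Odd (ℓ + 1)} {hM : Odd Mh} {hMh : 1 ≤ Mh} {hP : ∀ μ, 1 ≤ P μ} {hk : k' ≤ k} {hlev : ∀ x, F.lev x ≤ k'}
    {hm : ∀ μ, mir μ = true → 2 ≤ m μ} {hg : ∀ μ, sTop ℓ Mh k' ∣ g μ} (hfit : ∀ μ, mir μ = true → nMir ℓ Mh k' m μ + sTop ℓ Mh k' ≤ (N0 ℓ Mh k P μ : ℤ)) (a : ℕ → ℝ) (ha : ∀ j, 0 < a j)
    (hmarg : ∀ x : ↥(boxDom (N0 ℓ Mh k' (Pref ℓ k k' P mir m))),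
      x ∈ mirBoxOpen (N0 ℓ Mh k' (Pref ℓ k k' P mir m)) mir (nMir ℓ Mh k' m) (fun _ => hMir ℓ Mh k') →
      ∀ z : ↥(boxDom (N0 ℓ Mh k' (Pref ℓ k k' P mir m))),
        blk ((ℓ + 1) ^ (reflected F k' mir m g hL hM hMh hP hk hlev hm hg).lev x.1) z.1 = blk ((ℓ + 1) ^ (reflected F k' mir m g hL hM hMh hP hk hlev hm hg).lev x.1) x.1 →
        z ∈ mirBoxOpen (N0 ℓ Mh k' (Pref ℓ k k' P mir m)) mir (nMir ℓ Mh k' m) (fun _ => hMir ℓ Mh k'))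
    (f : ↥(mirBoxOpen (N0 ℓ Mh k' (Pref ℓ k k' P mir m)) mir (nMir ℓ Mh k' m) (fun _ => hMir ℓ Mh k')) → ℝ) (x : ↥(mirBoxOpen (N0 ℓ Mh k' (Pref ℓ k k' P mir m)) mir (nMir ℓ Mh k' m) (fun _ => hMir ℓ Mh k'))) :
    (((mlOpT (N0 ℓ Mh k P) ℓ k F.lev a).submatrix (fun v : ↥(mirBoxOpen (N0 ℓ Mh k' (Pref ℓ k k' P mir m)) mir (nMir ℓ Mh k' m) (fun _ => hMir ℓ Mh k')) => (⟨B6MultiLevelTorusMirrorL0.emb (ℓ := ℓ) (Mh := Mh) (k := k) (P := P) g v.1.1, emb_mem hMh hP g v.1.1⟩ : ↥(boxDom (N0 ℓ Mh k P)))) (fun v : ↥(mirBoxOpen (N0 ℓ Mh k' (Pref ℓ k k' P mir m)) mir (nMir ℓ Mh k' m) (fun _ => hMir ℓ Mh k')) => (⟨B6MultiLevelTorusMirrorL0.emb (ℓ := ℓ) (Mh := Mh) (k := k) (P := P) g v.1.1, emb_mem hMh hP g v.1.1⟩ : ↥(boxDom (N0 ℓ Mh k P)))))⁻¹ *ᵥ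 f) x =
      ∑ y : ↥(mirBoxOpen (N0 ℓ Mh k' (Pref ℓ k k' P mir m)) mir (nMir ℓ Mh k' m) (fun _ => hMir ℓ Mh k')), (∑ ε ∈ mirIdx mir, tsign ℝ mir ε * (gmlT (N0 ℓ Mh k' (Pref ℓ k k' P mir m)) ℓ k' (reflected F k' mir m g hL hM hMh hP hk hlev hm hg).lev a) x.1 (trefl (hmir_of_top (k := k) (P := P) hL hM hMh hm) ε y.1)) * f y := by
  rw [inv_compress_emb_eq_signedImK (hL := hL) (hM := hM) (hMh := hMh) (hP := hP) (hk := hk) (hlev := hlev) (hm := hm) (hg := hg) hfit a ha hmarg,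
    Matrix.mulVec]
  rfl

end Rows

end

end Literature.MathematicalPhysics.QuantumFieldTheory.Balaban1983to89.B6MultiLevelTorusMirrorCompression
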